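import Literature.MathematicalPhysics.StatisticalMechanics.HcpSiteGeometry
import Literature.MathematicalPhysics.StatisticalMechanics.HcpHomogeneous

/-!
# `StackingHinge` (stmt-AtomisticToContinuum-14993), line `Sketch`: stub `stub_hcpNetFacts`

Two metric facts about the relaxed hcp net `hcpStacking a h` (`BarlowStacking.lean`) on the
certified parameter box `189/200 ≤ a ≤ 199/200`, `77/100 ≤ h ≤ 163/200`:

* (i) **connectivity through short steps**: every site is reached from `0` by a chain of sites of
  the net with consecutive distances `≤ 6/5` (stated with `Relation.ReflTransGen`);
* (ii) **covering radius `≤ 2`**: every point of `ℝ³` is within `2` of a site.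

Proof. (i) Induction along decreasing squared norm with
`HcpSiteGeometry.exists_closer_hcp_site`: a site `s ≠ 0` has a site `s'` of the net with
`dist s s'² ≤ max (a²) (a²/3 + h²)` and `‖s'‖² + m ≤ ‖s‖²`, `m = min (a²) (h² − a²/3)`; on the
box `max (a²) (a²/3 + h²) ≤ (6/5)²` and `m > 0`, so an induction on `n` with `‖s‖² ≤ n · m`
builds the chain (`Relation.ReflTransGen.tail`).  (ii) `HcpSiteGeometry.exists_hcp_site_near`:
some site at squared distance `≤ 3a²/4 + h² ≤ 4`.  All routine ([folklore]).
-/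

noncomputable section

namespace Summit.AtomisticToContinuum.Crystallization.Theorems.PricedHcpWindowsHcpNetFacts

open Literature.MathematicalPhysics.StatisticalMechanics

/-- On the parameter box the closer-neighbour step is short: `max (a²) (a²/3 + h²) ≤ (6/5)²`.
[folklore] -/
theorem hcpBox_step_sq_le {a h : ℝ} (ha₁ : 189 / 200 ≤ a) (ha₂ : a ≤ 199 / 200)
    (hh₁ : 77 / 100 ≤ h) (hh₂ : h ≤ 163 / 200) :
    max (a ^ 2) (a ^ 2 / 3 + h ^ 2) ≤ (6 / 5) ^ 2 := by
  refine max_le ?_ ?_ <;> nlinarith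

/-- On the parameter box the norm decrement of the closer-neighbour step is positive:
`0 < min (a²) (h² − a²/3)`. [folklore] -/
theorem hcpBox_decr_pos {a h : ℝ} (ha₁ : 189 / 200 ≤ a) (ha₂ : a ≤ 199 / 200)
    (hh₁ : 77 / 100 ≤ h) (_hh₂ : h ≤ 163 / 200) :
    0 < min (a ^ 2) (h ^ 2 - a ^ 2 / 3) := by
  refine lt_min ?_ ?_ <;> nlinarith

/-- **Connectivity of the hcp net through steps of length `≤ 6/5`**, for the sites of squared norm
`≤ n · min (a²) (h² − a²/3)`: induction on `n`, each step supplied by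
`exists_closer_hcp_site`. [folklore] -/
theorem hcpBox_reflTransGen_of_norm_sq_le {a h : ℝ} (ha₁ : 189 / 200 ≤ a) (ha₂ : a ≤ 199 / 200)
    (hh₁ : 77 / 100 ≤ h) (hh₂ : h ≤ 163 / 200) (n : ℕ) :
    ∀ z ∈ hcpStacking a h, ‖z‖ ^ 2 ≤ n * min (a ^ 2) (h ^ 2 - a ^ 2 / 3) →
      Relation.ReflTransGen (fun p q : EuclideanSpace ℝ (Fin 3) =>
        p ∈ hcpStacking a h ∧ q ∈ hcpStacking a h ∧ dist p q ≤ 6 / 5) 0 z := by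
  induction n with
  | zero =>
    intro z _ hzn
    have hz0 : ‖z‖ = 0 := by
      have h0 : ‖z‖ ^ 2 ≤ 0 := by simpa using hzn
      nlinarith [norm_nonneg z]
    rw [norm_eq_zero] at hz0
    subst hz0
    exact Relation.ReflTransGen.refl
  | succ n ih =>
    intro z hz hzn
    by_cases hz0 : z = 0
    · subst hz0
      exact Relation.ReflTransGen.refl
    obtain ⟨s', hs', hdist, hnorm⟩ := exists_closer_hcp_site a h hz hz0
    have hm := hcpBox_decr_pos ha₁ ha₂ hh₁ hh₂
    have hs'n : ‖s'‖ ^ 2 ≤ n * min (a ^ 2) (h ^ 2 - a ^ 2 / 3) := by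
      rw [Nat.cast_succ, add_mul, one_mul] at hzn
      linarith
    refine Relation.ReflTransGen.tail (ih s' hs' hs'n) ⟨hs', hz, ?_⟩
    have hsq : dist s' z ^ 2 ≤ (6 / 5) ^ 2 := by
      rw [dist_comm]
      exact hdist.trans (hcpBox_step_sq_le ha₁ ha₂ hh₁ hh₂)
    exact le_of_pow_le_pow_left₀ two_ne_zero (by norm_num) hsq

/-- **Stub `stub_hcpNetFacts` of line `Sketch`: the two net facts of the relaxed hcp net on the
parameter box `189/200 ≤ a ≤ 199/200`, `77/100 ≤ h ≤ 163/200`.** (i) Every site of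
`hcpStacking a h` is reached from `0` by a chain of sites with consecutive distances `≤ 6/5`
(`exists_closer_hcp_site`, induction along decreasing squared norm); (ii) every point of `ℝ³`
is within `2` of a site (`exists_hcp_site_near`: squared distance `≤ 3a²/4 + h² ≤ 4`).
[folklore] -/
theorem stub_hcpNetFacts : ∀ a h : ℝ, 189 / 200 ≤ a → a ≤ 199 / 200 → 77 / 100 ≤ h → h ≤ 163 / 200 → (∀ z ∈ Literature.MathematicalPhysics.StatisticalMechanics.hcpStacking a h, Relation.ReflTransGen (fun p q : EuclideanSpace ℝ (Fin 3) => p ∈ Literature.MathematicalPhysics.StatisticalMechanics.hcpStacking a h ∧ q ∈ Literature.MathematicalPhysics.StatisticalMechanics.hcpStacking a h ∧ dist p q ≤ 6 / 5) 0 z) ∧ (∀ p : EuclideanSpace ℝ (Fin 3), ∃ z ∈ Literature.MathematicalPhysics.StatisticalMechanics.hcpStacking a h, dist p z ≤ 2) := by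
  intro a h ha₁ ha₂ hh₁ hh₂
  refine ⟨fun z hz => ?_, fun p => ?_⟩
  · -- (i) connectivity: `‖z‖² ≤ n · m` for some `n`, then the induction above
    have hm := hcpBox_decr_pos ha₁ ha₂ hh₁ hh₂
    obtain ⟨n, hn⟩ := exists_nat_ge (‖z‖ ^ 2 / min (a ^ 2) (h ^ 2 - a ^ 2 / 3))
    rw [div_le_iff₀ hm] at hn
    exact hcpBox_reflTransGen_of_norm_sq_le ha₁ ha₂ hh₁ hh₂ n z hz hn
  · -- (ii) covering radius: `dist² ≤ 3a²/4 + h² ≤ 4`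
    have ha0 : a ≠ 0 := by positivity
    have hh0 : h ≠ 0 := by positivity
    obtain ⟨s, hs, hd⟩ := exists_hcp_site_near ha0 hh0 p
    refine ⟨s, hs, ?_⟩
    have hsq : dist p s ^ 2 ≤ 2 ^ 2 := by nlinarith
    exact le_of_pow_le_pow_left₀ two_ne_zero (by norm_num) hsq

end Summit.AtomisticToContinuum.Crystallization.Theorems.PricedHcpWindowsHcpNetFacts

end
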